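import Summits.QuantumFields.BalabanUV.Beta.D1BFx.CoframeWordPieces
import Summits.QuantumFields.BalabanUV.Beta.D1BFx.CoframeVertices

/-!
# `BalabanUV.Beta.D1BFx.CoframeWordsKfive` — road «BF-x» for binder row D1, slot (K), (II)-row (C2) «TB4-W CO-FRAME TABLE, m-UNIFORM MASS»,
# FILE δ3a «COFRAME WORDS k9 ∕ k5»: **THE TOTAL MASSES OF THE TABLES `k9Inf` AND `k5Inf` OF `cofPairInf`** against ABSTRACT θ-masses of the legs
# (`χ` for `lapU∘Cgh` ∕ `Cgh∘lapU`, `γ` for `Cgh`, `r` for `Rgt`) — eight words, no associativity needed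

HONEST DEPENDENCY (cell records, verbatim): «continuum YM on T⁴ ⇐ BetaPertH ∧ nine spine estimates (0/9 proved); BetaPertH ⇐ (D1) ∧ (D4) ∧
CAP+tail; G-an2-4 gates asym, D1 and NE2/3/4.»  HONEST FRAMING (cell contract, verbatim): «discharging `BetaPertH` makes Bałaban's UV stability
UNCONDITIONAL — a real constructive-QFT result; it is NOT the continuum limit and NOT the Clay problem.»  THIS MODULE DISCHARGES NOTHING of the
wall: [folklore] the eight words of `PackedCoframePairLimit.k9Inf ∕ k5Inf` read through δ1's shapes, δ1b's pieces and δ2's vertex letters.  No definition, no `def … : Prop`, nothing cited, 0 sorry.  0 root-level binders of row D1 discharged (hW ∕ hR-sockets ∕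
hSX-socket ∕ D1Tel ∕ D1Rep = 0); (K) NOT closed; (C1)(C2) NOT closed here; NOT D1, NOT `BetaPertH`, NOT continuum, NOT Clay.

ABSOLUTE RULE (cell charter, verbatim): «No internally-minted statement may enter as a cited fact. Every hypothesis is either kernel-proved in
this package or a verbatim quotation of a PUBLISHED theorem with page reference. The manuscript(s) under audit are NOT citable for their own
disputed steps — they are the thing under adjudication; programme-internal (2001/route/tribunal) claims are never citable.»

WHY.  `k9Inf = dSw ((lapU∘Cgh) ∘ d2W) − jetCw w′ ((lapU∘Cgh) ∘ gW w) − jetCw w ((lapU∘Cgh) ∘ gW w′) + jetCw (w·w′) Rgt` and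
`k5Inf = dSw (gW w ∘ Cgh ∘ gW w′) − jetCw w′ (gW w ∘ (Cgh∘lapU)) + jetRw w ((lapU∘Cgh) ∘ gW w′) − jetRCw w w′ Rgt` are literally the shapes of δ1 with
the vertices of δ2 and one leg each; every word's total mass is (outer leg mass) × (ONE `Zl 4 (δ−θ)`) × `e^{−θ|P−P′|₁}` × the weights' amplitudes.

CONTENT (all [folklore]; weights `|w κ u| ≤ C·e^{−δ|u−P|₁}`, `|w′ κ u| ≤ C′·e^{−δ|u−P′|₁}`, `0 ≤ θ < δ`; `Z := Zl 4 (δ−θ)`, `S := e^{−θ|P−P′|₁}`).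
* §1 `totMass_k9a` (`64·χ·8·C·C′·Z·S`), `totMass_k9b ∕ k9c` (`32·(χ·8Ce^δ)·e^δ·C′·Z·S` — weight next to the vertex), `totMass_k9d` (`32·r·C·C′·Z·S`),
  **`totMass_k9Inf`**.
* §2 `totMass_k5a` (`64·(8Ce^δ)(8C′e^δ)·γ·Z·S` — the sandwich), `totMass_k5b` (`32·(8Ce^δ)·C′·e^θχ·Z·S`), `totMass_k5c` (`jetRw` by transposition,
  `trK_gW`), `totMass_k5d` (`16·C·C′·e^{2θ}r·Z·S`), **`totMass_k5Inf`**.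
NOT HERE: the `qW`∕`l2W` words `k7Inf ∕ k4Inf` and `cofPairInf` (δ3b `CoframeWordsKfour`), the road instantiation (δ4b `CoframeMassUniform`).
Unit `b2b-balaban-gan24-formalise-leaf-05` (gen 54), G-an2-4 swarm leaf prover 05, road «BF-x» (C1)(C2) count owner (OWNER RULING ρ-g19-1 AMENDED l.43347,
ρ-g19-2: the END's currency is the subsequence `n = L^k`); INTENT «COFRAME WORDS ∕ UNIFORM» (journal).
-/

noncomputable section

namespace Summit.QuantumFields.BalabanUV.Beta.D1BFx.CoframeWordsKfive

open scoped BigOperators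
open Finset
open Literature.MathematicalPhysics.QuantumFieldTheory.Balaban1983to89
open Literature.MathematicalPhysics.QuantumFieldTheory.Balaban1983to89.Beta
open B12Sec2to5 (l1 l1_nonneg)
open ExpKernelCalculus (Site MKer comp Zl Zl_pos l1_sub_triangle l1_sub_symm)
open AffineAveraging (unitVec)
open Summit.QuantumFields.BalabanUV.Beta.D1BFx.TorusGhostWordArrays (lapU)
open Summit.QuantumFields.BalabanUV.Beta.TameKernelCalculus (trK trK_trK trK_comp comp_neg_left)
open Summit.QuantumFields.BalabanUV.Beta.D1BFx.RJetAssembly (dSw)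
open Summit.QuantumFields.BalabanUV.Beta.D1BFx.PackedPinnedLetters (jetRw jetCw jetRCw)
open Summit.QuantumFields.BalabanUV.Beta.D1BFx.GhostStencil (l1_unitVec l1_zero)
open Summit.QuantumFields.BalabanUV.Beta.D1BFx.KGhostLeg (Cgh)
open Summit.QuantumFields.BalabanUV.Beta.D1BFx.RJetProjector (Rgt)
open Summit.QuantumFields.BalabanUV.Beta.D1BFx.PackedCoframeSiteWords (gW d2W)
open Summit.QuantumFields.BalabanUV.Beta.D1BFx.PackedCoframePairLimit (k9Inf k5Inf)
open Summit.QuantumFields.BalabanUV.Beta.D1BFx.KernelMassCalculus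
open Summit.QuantumFields.BalabanUV.Beta.D1BFx.KernelMassTotal
open Summit.QuantumFields.BalabanUV.Beta.D1BFx.CoframeWordShapes
open Summit.QuantumFields.BalabanUV.Beta.D1BFx.CoframeWordPieces
open Summit.QuantumFields.BalabanUV.Beta.D1BFx.CoframeVertices

variable {n : ℕ} [NeZero n] {a : ℝ} {w w' : Fin 4 → Site 4 → ℝ} {C C' δ θ χ γ r : ℝ} {P P' : Site 4}

/-! ## §1 The four words of `k9Inf` -/

section K9

/-- [folklore] **(9a)** `dSw ((lapU∘Cgh) ∘ d2W w w′)`: `64·(χ·(8·C·C′·Zl·S))`. -/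
theorem totMass_k9a (hw : ∀ κ u, |w κ u| ≤ C * Real.exp (-δ * l1 (u - P))) (hw' : ∀ κ u, |w' κ u| ≤ C' * Real.exp (-δ * l1 (u - P')))
    (hθ : 0 ≤ θ) (hθδ : θ < δ) (hX : ColMass (comp lapU (Cgh n a)) 0 χ) :
    TotMass (dSw (comp (comp lapU (Cgh n a)) (d2W w w')))
      (64 * (χ * (8 * ((C * C') * Zl 4 (δ - θ) * Real.exp (-θ * l1 (P - P')))))) :=
  totMass_dSw (totMass_comp_left hX (totMass_d2W hw hw' hθ hθδ))

/-- [folklore] **(9b)** `jetCw w′ ((lapU∘Cgh) ∘ gW w)` (weight and vertex on the same side): `32·((χ·(8·C·e^δ))·e^δ·C′·Zl·S)`. -/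
theorem totMass_k9b (hw : ∀ κ u, |w κ u| ≤ C * Real.exp (-δ * l1 (u - P))) (hw' : ∀ κ u, |w' κ u| ≤ C' * Real.exp (-δ * l1 (u - P')))
    (hθ : 0 ≤ θ) (hθδ : θ < δ) (hX : RowMass (comp lapU (Cgh n a)) 0 χ ∧ ColMass (comp lapU (Cgh n a)) 0 χ) :
    TotMass (jetCw w' (comp (comp lapU (Cgh n a)) (gW w)))
      (32 * (χ * (8 * C * Real.exp δ) * Real.exp δ * C' * Zl 4 (δ - θ) * Real.exp (-θ * l1 (P - P')))) := by
  have hδ : 0 ≤ δ := hθ.trans hθδ.le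
  have hV := masses_gW hw hδ
  have hVrow : RowMass (comp (comp lapU (Cgh n a)) (gW w)) 0 (χ * (8 * C * Real.exp δ)) := rowMass_comp hX.1 hV.1 le_rfl
  have hVcol : ∀ y, (Summable fun u => rowFn (comp (comp lapU (Cgh n a)) (gW w)) 0 u y) ∧
      ∑' u, rowFn (comp (comp lapU (Cgh n a)) (gW w)) 0 u y ≤ χ * (8 * C * Real.exp δ) * Real.exp (-δ * l1 (y - P)) := fun y =>
    ⟨(cols_comp_left hX.2 (cols_gW hw hδ) y).1, (cols_comp_left hX.2 (cols_gW hw hδ) y).2.trans_eq (by ring)⟩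
  refine totMass_jetCw_of_pieces fun β s => ?_
  have h := totMass_piece_same hVrow hVcol hθ hθδ (hw' β) s (unitVec β)
  rw [l1_unitVec, mul_one] at h
  exact h

/-- [folklore] **(9c)** `jetCw w ((lapU∘Cgh) ∘ gW w′)`: `32·((χ·(8·C′·e^δ))·e^δ·C·Zl·S)`. -/
theorem totMass_k9c (hw : ∀ κ u, |w κ u| ≤ C * Real.exp (-δ * l1 (u - P))) (hw' : ∀ κ u, |w' κ u| ≤ C' * Real.exp (-δ * l1 (u - P')))
    (hθ : 0 ≤ θ) (hθδ : θ < δ) (hX : RowMass (comp lapU (Cgh n a)) 0 χ ∧ ColMass (comp lapU (Cgh n a)) 0 χ) :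
    TotMass (jetCw w (comp (comp lapU (Cgh n a)) (gW w')))
      (32 * (χ * (8 * C' * Real.exp δ) * Real.exp δ * C * Zl 4 (δ - θ) * Real.exp (-θ * l1 (P - P')))) := by
  rw [l1_sub_symm]
  exact totMass_k9b hw' hw hθ hθδ hX

omit [NeZero n] in
/-- [folklore] **(9d)** `jetCw (w·w′) Rgt` (one summable weight on a leg): `32·(r·(C·C′·Zl·S))`. -/
theorem totMass_k9d (hw : ∀ κ u, |w κ u| ≤ C * Real.exp (-δ * l1 (u - P))) (hw' : ∀ κ u, |w' κ u| ≤ C' * Real.exp (-δ * l1 (u - P')))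
    (hθ : 0 ≤ θ) (hθδ : θ < δ) (hR : ColMass (Rgt n a) 0 r) :
    TotMass (jetCw (fun κ u => w κ u * w' κ u) (Rgt n a)) (32 * (r * ((C * C') * Zl 4 (δ - θ) * Real.exp (-θ * l1 (P - P'))))) := by
  have hS : ∀ κ : Fin 4, (Summable fun u => |w κ u * w' κ u|) ∧
      ∑' u, |w κ u * w' κ u| ≤ (C * C') * Zl 4 (δ - θ) * Real.exp (-θ * l1 (P - P')) := fun κ =>
    tsum_prodWeight_le (fun u => abs_prodWeight_le hw hw' κ u) hθ hθδ
  refine totMass_jetCw_of_pieces fun β s => ?_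
  exact totMass_mono (totMass_piece_summable hR (hS β).1 s (unitVec β)) (mul_le_mul_of_nonneg_left (hS β).2 hR.nonneg)

/-- [folklore] **THE TOTAL MASS OF `k9Inf`** against abstract `θ = 0` masses of `lapU∘Cgh` (`χ`) and `Rgt` (`r`). -/
theorem totMass_k9Inf (hw : ∀ κ u, |w κ u| ≤ C * Real.exp (-δ * l1 (u - P))) (hw' : ∀ κ u, |w' κ u| ≤ C' * Real.exp (-δ * l1 (u - P')))
    (hθ : 0 ≤ θ) (hθδ : θ < δ) (hX : RowMass (comp lapU (Cgh n a)) 0 χ ∧ ColMass (comp lapU (Cgh n a)) 0 χ) (hR : ColMass (Rgt n a) 0 r) :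
    TotMass (k9Inf n a w w')
      (64 * (χ * (8 * ((C * C') * Zl 4 (δ - θ) * Real.exp (-θ * l1 (P - P')))))
        + 32 * (χ * (8 * C * Real.exp δ) * Real.exp δ * C' * Zl 4 (δ - θ) * Real.exp (-θ * l1 (P - P')))
        + 32 * (χ * (8 * C' * Real.exp δ) * Real.exp δ * C * Zl 4 (δ - θ) * Real.exp (-θ * l1 (P - P')))
        + 32 * (r * ((C * C') * Zl 4 (δ - θ) * Real.exp (-θ * l1 (P - P'))))) := by
  unfold k9Inf
  exact totMass_add (totMass_sub (totMass_sub (totMass_k9a hw hw' hθ hθδ hX.2) (totMass_k9b hw hw' hθ hθδ hX))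
    (totMass_k9c hw hw' hθ hθδ hX)) (totMass_k9d hw hw' hθ hθδ hR)

end K9

/-! ## §2 The four words of `k5Inf` -/

section K5

/-- [folklore] **(5a)** `dSw (gW w ∘ Cgh ∘ gW w′)` (the sandwich itself): `64·((8·C·e^δ)·(8·C′·e^δ)·γ·Zl·S)`. -/
theorem totMass_k5a (hw : ∀ κ u, |w κ u| ≤ C * Real.exp (-δ * l1 (u - P))) (hw' : ∀ κ u, |w' κ u| ≤ C' * Real.exp (-δ * l1 (u - P')))
    (hθ : 0 ≤ θ) (hθδ : θ < δ) (hC : RowMass (Cgh n a) θ γ) :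
    TotMass (dSw (comp (comp (gW w) (Cgh n a)) (gW w')))
      (64 * ((8 * C * Real.exp δ) * (8 * C' * Real.exp δ) * γ * Zl 4 (δ - θ) * Real.exp (-θ * l1 (P - P')))) := by
  have hδ : 0 ≤ δ := hθ.trans hθδ.le
  exact totMass_dSw (totMass_sandwich (masses_gW hw hδ).1 (cols_gW hw hδ) hC hθ hθδ (masses_gW hw' hδ).2 (rows_gW hw' hδ))

/-- [folklore] **(5b)** `jetCw w′ (gW w ∘ (Cgh∘lapU))` (weight and vertex on opposite sides of the leg): `32·((8·C·e^δ)·C′·(e^θ·χ)·Zl·S)`. -/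
theorem totMass_k5b (hw : ∀ κ u, |w κ u| ≤ C * Real.exp (-δ * l1 (u - P))) (hw' : ∀ κ u, |w' κ u| ≤ C' * Real.exp (-δ * l1 (u - P')))
    (hθ : 0 ≤ θ) (hθδ : θ < δ) (hXt : RowMass (comp (Cgh n a) lapU) θ χ) :
    TotMass (jetCw w' (comp (gW w) (comp (Cgh n a) lapU)))
      (32 * ((8 * C * Real.exp δ) * C' * (Real.exp θ * χ) * Zl 4 (δ - θ) * Real.exp (-θ * l1 (P - P')))) := by
  have hδ : 0 ≤ δ := hθ.trans hθδ.le
  refine totMass_jetCw_of_pieces fun β s => ?_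
  have h := totMass_piece_opp (masses_gW hw hδ).1 (cols_gW hw hδ) hXt hθ hθδ (hw' β) s (unitVec β)
  rw [l1_unitVec, mul_one] at h
  exact h

/-- [folklore] **(5c)** `jetRw w ((lapU∘Cgh) ∘ gW w′)` (transposed: `gW w′` is antisymmetric, the leg's column mass becomes a row mass):
`32·((8·C′·e^δ)·C·(e^θ·χ)·Zl·S)`. -/
theorem totMass_k5c (hw : ∀ κ u, |w κ u| ≤ C * Real.exp (-δ * l1 (u - P))) (hw' : ∀ κ u, |w' κ u| ≤ C' * Real.exp (-δ * l1 (u - P')))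
    (hθ : 0 ≤ θ) (hθδ : θ < δ) (hX : ColMass (comp lapU (Cgh n a)) θ χ) :
    TotMass (jetRw w (comp (comp lapU (Cgh n a)) (gW w')))
      (32 * ((8 * C' * Real.exp δ) * C * (Real.exp θ * χ) * Zl 4 (δ - θ) * Real.exp (-θ * l1 (P - P')))) := by
  have hδ : 0 ≤ δ := hθ.trans hθδ.le
  have hB : RowMass (trK (comp lapU (Cgh n a))) θ χ := colMass_iff_rowMass_trK.1 hX
  refine totMass_jetRw_of_pieces fun β s => ?_
  have h := totMass_piece_opp (masses_gW hw' hδ).1 (cols_gW hw' hδ) hB hθ hθδ (hw β) s (unitVec β)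
  rw [l1_unitVec, mul_one, l1_sub_symm] at h
  have e : (fun x z (_ _ : Unit) => w β z * trK (comp (comp lapU (Cgh n a)) (gW w')) (x + s) (z + unitVec β) () ())
      = -(fun x z (_ _ : Unit) => w β z * comp (gW w') (trK (comp lapU (Cgh n a))) (x + s) (z + unitVec β) () ()) := by
    rw [trK_comp, trK_gW, comp_neg_left]
    funext x z c d
    simp only [Pi.neg_apply, mul_neg]
  rw [e]
  exact totMass_neg h

omit [NeZero n] in
/-- [folklore] **(5d)** `jetRCw w w′ Rgt` (two weights around the leg): `16·(C·C′·(e^θ·(e^θ·r))·Zl·S)`. -/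
theorem totMass_k5d (hw : ∀ κ u, |w κ u| ≤ C * Real.exp (-δ * l1 (u - P))) (hw' : ∀ κ u, |w' κ u| ≤ C' * Real.exp (-δ * l1 (u - P')))
    (hθ : 0 ≤ θ) (hθδ : θ < δ) (hR : RowMass (Rgt n a) θ r) :
    TotMass (jetRCw w w' (Rgt n a)) (16 * (C * C' * (Real.exp θ * (Real.exp θ * r)) * Zl 4 (δ - θ) * Real.exp (-θ * l1 (P - P')))) := by
  refine totMass_jetRCw_of_pieces fun α β => ?_
  have h := totMass_piece_rc (hw α) (hw' β) hR hθ hθδ (unitVec α) (unitVec β)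
  rw [l1_unitVec, l1_unitVec, mul_one] at h
  exact h

/-- [folklore] **THE TOTAL MASS OF `k5Inf`** against abstract θ-masses of `Cgh` (`γ`), `lapU∘Cgh`, `Cgh∘lapU` (`χ`) and `Rgt` (`r`). -/
theorem totMass_k5Inf (hw : ∀ κ u, |w κ u| ≤ C * Real.exp (-δ * l1 (u - P))) (hw' : ∀ κ u, |w' κ u| ≤ C' * Real.exp (-δ * l1 (u - P')))
    (hθ : 0 ≤ θ) (hθδ : θ < δ) (hC : RowMass (Cgh n a) θ γ) (hX : ColMass (comp lapU (Cgh n a)) θ χ)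
    (hXt : RowMass (comp (Cgh n a) lapU) θ χ) (hR : RowMass (Rgt n a) θ r) :
    TotMass (k5Inf n a w w')
      (64 * ((8 * C * Real.exp δ) * (8 * C' * Real.exp δ) * γ * Zl 4 (δ - θ) * Real.exp (-θ * l1 (P - P')))
        + 32 * ((8 * C * Real.exp δ) * C' * (Real.exp θ * χ) * Zl 4 (δ - θ) * Real.exp (-θ * l1 (P - P')))
        + 32 * ((8 * C' * Real.exp δ) * C * (Real.exp θ * χ) * Zl 4 (δ - θ) * Real.exp (-θ * l1 (P - P')))
        + 16 * (C * C' * (Real.exp θ * (Real.exp θ * r)) * Zl 4 (δ - θ) * Real.exp (-θ * l1 (P - P')))) := by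
  unfold k5Inf
  exact totMass_sub (totMass_add (totMass_sub (totMass_k5a hw hw' hθ hθδ hC) (totMass_k5b hw hw' hθ hθδ hXt))
    (totMass_k5c hw hw' hθ hθδ hX)) (totMass_k5d hw hw' hθ hθδ hR)

end K5

end Summit.QuantumFields.BalabanUV.Beta.D1BFx.CoframeWordsKfive

end
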